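import Literature.AlgebraicGeometry.AbelianSchemes.SerreCoverKerAlongPointBaseChange   -- ★ p849565 (LA4-p03 (g2)) `coverKer_readAt_comp`; re-exports ★ `coverKer∕cover_baseChange_of_transfer`, the transfers, the comparison isos
import HarnessLib

/-!
# The Serre cover of a PEL family read at two `Ω`-points moves along ANY `x : Spec Ω′ → Spec Ω` — WITHOUT the kernel clause, and BY VALUE (the descent `ℂ → F̄_w`)

Topic `AlgebraicGeometry/AbelianSchemes`; namespace `Literature.AlgebraicGeometry.AbelianSchemes.AbelianSchemeOver`.  THEOREMS ONLY (no definition,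
no named fact, no instance, no notation, no `sorry`); universe-polymorphic.  Cell `hodgecm-mathlib` (D-0151), P6 «MOD programme» (crux hLiu418 =
stmt-HodgeConjecture-24832, `--supports`, count-neutral), line «L4», the (S5) «`ℂ ↔ F̄_w` seam» of the `stub_SHEET` closer (LA4-plan (g2) DEAL #31;
lead LA7-p01 (g3), LEG-D: the (K-law)∕(cover) rows `CoverKerE`∕`CoverE` of the E-readings are produced at the COMPLEX points `Spec σ ≫ ℓ_{e′} y` of
`X = (S.M Kc) ⊗_F Fᵢ` (`σ : F̄_w ≃ ℂ` over `ι₁`, ★ `AdicCompletionAlgClosureEquivComplex`) and must be READ BACK at the `F̄_w`-sheet points `ℓ_{e′} y`).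
Sequel of ★ `SerreCoverKerAlongPointBaseChange` (LA4-p03 (g2)): that file moves the SEVEN-clause cover-with-kernel-clause shape of ONE family
`(𝒜, ρ, (Â, 𝒫), λ, lvl)` over `Y` read at `(ℓ₁, ℓ₂)` to `(x ≫ ℓ₁, x ≫ ℓ₂)` for every `x : Spec Ω′ → Spec Ω`.  Here:

* §1 **`cover_readAt_comp`** — the SIX-clause twin WITHOUT the kernel clause (t1′) (= the body of the E-reading `CoverE` ∕ the spine reader `CoverΩ`:
  (t1) Serre presentation of `𝔞`, (t2) upper bound through `𝔟` and `ν`, (t3) `c ≫ λ₂ ≫ c^∨ = λ₁ ≫ [N]`, (t4) `ι`-equivariance, (t5) level points), same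
  three ★ steps: base change along `x` with transferred level points (★ `cover_baseChange_of_transfer`), the exact comparison isomorphisms
  `(𝒜 ×_Y ℓᵢ) ×_Ω Spec Ω′ ≅ 𝒜 ×_Y (x ≫ ℓᵢ)` (★ `exists_iso_of_tupleRel_id` on ★ `tupleRel_baseChangeCompGrpIso_inv`), transport along them (★
  `cover_transport_along_iso`, point hypothesis ★ `map_pointsTransfer_restrictPt_of_left_eq_baseChangeCompGrpIso_inv`);
* §2 **`coverKer_readAt_comp_of_eq`**, **`cover_readAt_comp_of_eq`** — THE BY-VALUE FORMS: the target points `m₁, m₂ : Spec Ω′ → Y` are given with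
  `hmᵢ : x ≫ ℓᵢ = mᵢ` (dependent types: `𝒜 ×_Y (x ≫ ℓ)` and `𝒜 ×_Y m` are different types; proof `subst`).  THIS IS THE DESCENT `ℂ → F̄_w`: with
  `x := Spec σ⁻¹ : Spec F̄_w → Spec ℂ`, `ℓᵢ :=` the complex points `Spec σ ≫ ℓ_{e} y`, `mᵢ := ℓ_{e} y` and `hmᵢ` = `Spec σ⁻¹ ≫ Spec σ = 𝟙` (★
  `specMap_algEquiv_symm_comp_specMap`) — no isomorphism hypothesis is needed for covers (unlike the isogeny roof of ★ `roof_readAt_comp_of_eq`, whose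
  kernel-on-points and surjectivity clauses need `IsIso x`);
* §3 `coverKer_readAt_of_readAt_isIso_comp`, `cover_readAt_of_readAt_isIso_comp` — the same spelled with `[IsIso x]`: the reading at `(x ≫ ℓ₁, x ≫ ℓ₂)`
  over `Ω′` gives back the reading at `(ℓ₁, ℓ₂)` over `Ω` (§2 at `inv x`, `inv x ≫ x ≫ ℓᵢ = ℓᵢ`).
HC_CM is proved only modulo the 2 remaining named inputs (hLiu418 24832, h413 24833) until rung 0 closes; nothing here is about HC.

THE MATHEMATICS ([GortzWedhorn2020] (4.7), Prop. 4.16; [MumfordFogartyKirwan1994] Ch. 6 §1 Cor. 6.4∕6.8, Ch. 7 §2 Def. 7.2–7.3; [Shimura1998] §13.1 Thm. 1 ∕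
§18.6; [Conrad2004GrossZagier] §7 Thm. 7.5: the Serre `𝔞`-transform between CM fibres and all its structure maps are compatible with extension of the field
of definition of the point, and `𝒜 ×_Y (x ≫ ℓ) ≅ (𝒜 ×_Y ℓ) ×_Ω Spec Ω′` canonically, compatibly with every structure).

## References
* [GortzWedhorn2020] U. Görtz, T. Wedhorn, *Algebraic Geometry I*, 2nd ed. (2020), Section (4.7) (pp. 107–108), Prop. 4.16 (p. 101).
* [MumfordFogartyKirwan1994] D. Mumford, J. Fogarty, F. Kirwan, *Geometric Invariant Theory*, 3rd ed. (1994), Ch. 6 §1 Cor. 6.4 (p. 117), Cor. 6.8 (p. 118); Ch. 7 §2 Def. 7.2 (p. 129), Def. 7.3 (p. 130).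
* [Shimura1998] G. Shimura, *Abelian Varieties with Complex Multiplication and Modular Functions* (1998), §13.1 Theorem 1 (pp. 97–99), §18.6 (pp. 124–127).
* [Conrad2004GrossZagier] B. Conrad, *Gross–Zagier revisited* (2004), §7 Thm. 7.5.
* [MumfordAV1970] D. Mumford, *Abelian Varieties* (1970), §15 Thm. 1 (p. 143).
-/

set_option autoImplicit false

noncomputable section

-- Mathlib's `Over`/pull-back API is stated across semireducible wrappers (as in the ★ `AbelianSchemes/*` files).
set_option backward.isDefEq.respectTransparency false

universe u

open CategoryTheory CategoryTheory.Limits AlgebraicGeometry MonoidalCategory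
open scoped MonObj Obj

namespace Literature.AlgebraicGeometry.AbelianSchemes

namespace AbelianSchemeOver

open Literature.AlgebraicGeometry.Motives (AlgPoints specOver)

/-! ### §1 The cover shape WITHOUT the kernel clause, read at `(ℓ₁, ℓ₂)`, moves to `(x ≫ ℓ₁, x ≫ ℓ₂)` -/

section ReadAt

variable {Y : Scheme.{u}} (𝒜 : AbelianSchemeOver Y) {O : Type*} [CommRing O] (ρ : RingAction O 𝒜) (D : 𝒜.DualPair)
  (hD : Nonempty ((Scheme.Modules.pullback D.unitHatSlice).obj D.P ≅ SheafOfModules.unit _))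
  (pol : 𝒜.Polarization D) {g n : ℕ} (lvl : 𝒜.LevelStructure g n)
  {Ω Ω' : Type u} [Field Ω] [Field Ω'] (ℓ₁ ℓ₂ : Spec (.of Ω) ⟶ Y) (x : Spec (.of Ω') ⟶ Spec (.of Ω))
  (𝔞 𝔟 : O → Prop) (ν : O) (N : ℕ)

include hD in
/-- **THE SERRE COVER (NO KERNEL CLAUSE), READ AT `(ℓ₁, ℓ₂)`, MOVES TO `(x ≫ ℓ₁, x ≫ ℓ₂)`** — the six-clause twin of ★ `coverKer_readAt_comp`: input∕output
clause texts = the E-reading `CoverE` ((t1) Serre presentation of `𝔞`, (t2) upper bound through `𝔟` and `ν`, (t3) `c ≫ λ₂ ≫ c^∨ = λ₁ ≫ [N]`, (t4)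
`ι`-equivariance, (t5) level points `σᵃ`) with the readers of ONE family `(𝒜, ρ, D, pol, lvl)` at the two points spelled in their ★ bodies
(`baseChangeHom (ρ.i a) ℓ = (fibreHom (ρ.i a) ℓ).hom.hom.hom` by `rfl`, `D.baseChange ℓ`, `(pol.baseChange ℓ).lam`, `𝒜.restrictPt ℓ (lvl.section_ a)`); `hD`
is the Poincaré normalisation `(1 × ε_Â)^*𝒫 ≅ 𝒪` of the family.  No hypothesis on `x`.  Proof: ★ `cover_baseChange_of_transfer` (base change along `x`, level
points by the transfers ★ `exists_pointsTransfer`), ★ `exists_iso_of_tupleRel_id` ∘ ★ `tupleRel_baseChangeCompGrpIso_inv` (the exact comparison isomorphisms),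
★ `cover_transport_along_iso`. [cite: MumfordFogartyKirwan1994, Ch. 7 §2 Definition 7.2 (p. 129) and Definition 7.3 (p. 130)]
[cite: GortzWedhorn2020, Section (4.7) (pp. 107–108) and Prop. 4.16 (p. 101)] [cite: Shimura1998, §13.1 Theorem 1 (pp. 97–99); §18.6 (pp. 124–127)] -/
theorem cover_readAt_comp
    (hcover : ∃ (c : (𝒜.baseChange ℓ₁).X ⟶ (𝒜.baseChange ℓ₂).X) (_ : IsMonHom c),
        (∀ a, 𝔞 a → ∃ d : (𝒜.baseChange ℓ₂).X ⟶ (𝒜.baseChange ℓ₁).X,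
          c ≫ d = baseChangeHom (ρ.i a) ℓ₁ ∧ d ≫ c = baseChangeHom (ρ.i a) ℓ₂) ∧
        (∀ b, 𝔟 b → ∃ f : (𝒜.baseChange ℓ₁).X ⟶ (𝒜.baseChange ℓ₂).X,
          c ≫ baseChangeHom (ρ.i b) ℓ₂ = f ≫ baseChangeHom (ρ.i ν) ℓ₂) ∧
        c ≫ (pol.baseChange ℓ₂).lam ≫ DualPair.dualIsogenyOver c (D.baseChange ℓ₁) (D.baseChange ℓ₂) =
          (pol.baseChange ℓ₁).lam ≫ (D.baseChange ℓ₁).hat.mulN N ∧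
        (∀ a, baseChangeHom (ρ.i a) ℓ₁ ≫ c = c ≫ baseChangeHom (ρ.i a) ℓ₂) ∧
        (∀ a : Fin g ⊕ Fin g → ZMod n,
          (AlgPoints.map c (𝒜.restrictPt ℓ₁ (lvl.section_ a)) : (𝒜.baseChange ℓ₂).toAffine.toAbelianVariety.Points Ω) =
            𝒜.restrictPt ℓ₂ (lvl.section_ a))) :
    ∃ (c : (𝒜.baseChange (x ≫ ℓ₁)).X ⟶ (𝒜.baseChange (x ≫ ℓ₂)).X) (_ : IsMonHom c),
        (∀ a, 𝔞 a → ∃ d : (𝒜.baseChange (x ≫ ℓ₂)).X ⟶ (𝒜.baseChange (x ≫ ℓ₁)).X,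
          c ≫ d = baseChangeHom (ρ.i a) (x ≫ ℓ₁) ∧ d ≫ c = baseChangeHom (ρ.i a) (x ≫ ℓ₂)) ∧
        (∀ b, 𝔟 b → ∃ f : (𝒜.baseChange (x ≫ ℓ₁)).X ⟶ (𝒜.baseChange (x ≫ ℓ₂)).X,
          c ≫ baseChangeHom (ρ.i b) (x ≫ ℓ₂) = f ≫ baseChangeHom (ρ.i ν) (x ≫ ℓ₂)) ∧
        c ≫ (pol.baseChange (x ≫ ℓ₂)).lam ≫ DualPair.dualIsogenyOver c (D.baseChange (x ≫ ℓ₁)) (D.baseChange (x ≫ ℓ₂)) =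
          (pol.baseChange (x ≫ ℓ₁)).lam ≫ (D.baseChange (x ≫ ℓ₁)).hat.mulN N ∧
        (∀ a, baseChangeHom (ρ.i a) (x ≫ ℓ₁) ≫ c = c ≫ baseChangeHom (ρ.i a) (x ≫ ℓ₂)) ∧
        (∀ a : Fin g ⊕ Fin g → ZMod n,
          (AlgPoints.map c (𝒜.restrictPt (x ≫ ℓ₁) (lvl.section_ a)) : (𝒜.baseChange (x ≫ ℓ₂)).toAffine.toAbelianVariety.Points Ω') =
            𝒜.restrictPt (x ≫ ℓ₂) (lvl.section_ a)) := by
  classical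
  -- (1) base change along `x`, the level points moved by transfers
  obtain ⟨ε₁, hε₁⟩ := exists_pointsTransfer x (𝒜.baseChange ℓ₁)
  obtain ⟨ε₂, hε₂⟩ := exists_pointsTransfer x (𝒜.baseChange ℓ₂)
  have hbc := cover_baseChange_of_transfer x (D.baseChange ℓ₁) (D.baseChange ℓ₂) (pol.baseChange ℓ₁).lam (pol.baseChange ℓ₂).lam
    (fun a => baseChangeHom (ρ.i a) ℓ₁) (fun a => baseChangeHom (ρ.i a) ℓ₂)
    (fun a : Fin g ⊕ Fin g → ZMod n => (𝒜.restrictPt ℓ₁ (lvl.section_ a) : (𝒜.baseChange ℓ₁).toAffine.toAbelianVariety.Points Ω))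
    (fun a : Fin g ⊕ Fin g → ZMod n => (𝒜.restrictPt ℓ₂ (lvl.section_ a) : (𝒜.baseChange ℓ₂).toAffine.toAbelianVariety.Points Ω))
    𝔞 𝔟 ν N hε₁ hε₂ (fun a => ε₁ (𝒜.restrictPt ℓ₁ (lvl.section_ a))) (fun a => ε₂ (𝒜.restrictPt ℓ₂ (lvl.section_ a)))
    (fun _ => rfl) (fun _ => rfl) hcover
  -- the Poincaré pins of all the base-changed dual pairs
  have hD₁ := DualPair.nonempty_unitHatSlice_baseChange_iso (g := x) (D.baseChange ℓ₁) (DualPair.nonempty_unitHatSlice_baseChange_iso (g := ℓ₁) D hD)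
  have hD₁' := DualPair.nonempty_unitHatSlice_baseChange_iso (g := x) (D.baseChange ℓ₂) (DualPair.nonempty_unitHatSlice_baseChange_iso (g := ℓ₂) D hD)
  have hD₂ := DualPair.nonempty_unitHatSlice_baseChange_iso (g := x ≫ ℓ₁) D hD
  have hD₂' := DualPair.nonempty_unitHatSlice_baseChange_iso (g := x ≫ ℓ₂) D hD
  -- (2) the exact comparison isomorphisms `(𝒜 ×_Y ℓᵢ) ×_Ω Spec Ω′ ≅ 𝒜 ×_Y (x ≫ ℓᵢ)`
  obtain ⟨e₁, he₁mon, he₁left, -, he₁lam, he₁σ, he₁act⟩ := exists_iso_of_tupleRel_id ((D.baseChange ℓ₁).baseChange x) (D.baseChange (x ≫ ℓ₁))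
    (baseChangeHom (pol.baseChange ℓ₁).lam x) (pol.baseChange (x ≫ ℓ₁)).lam hD₂ ((lvl.baseChange ℓ₁).baseChange x) (lvl.baseChange (x ≫ ℓ₁))
    (fun a => baseChangeHom (baseChangeHom (ρ.i a) ℓ₁) x) (fun a => baseChangeHom (ρ.i a) (x ≫ ℓ₁))
    (tupleRel_baseChangeCompGrpIso_inv 𝒜 ρ D pol lvl ℓ₁ x)
  obtain ⟨e₂, he₂mon, he₂left, -, he₂lam, he₂σ, he₂act⟩ := exists_iso_of_tupleRel_id ((D.baseChange ℓ₂).baseChange x) (D.baseChange (x ≫ ℓ₂))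
    (baseChangeHom (pol.baseChange ℓ₂).lam x) (pol.baseChange (x ≫ ℓ₂)).lam hD₂' ((lvl.baseChange ℓ₂).baseChange x) (lvl.baseChange (x ≫ ℓ₂))
    (fun a => baseChangeHom (baseChangeHom (ρ.i a) ℓ₂) x) (fun a => baseChangeHom (ρ.i a) (x ≫ ℓ₂))
    (tupleRel_baseChangeCompGrpIso_inv 𝒜 ρ D pol lvl ℓ₂ x)
  haveI := he₁mon
  haveI := he₂mon
  -- (3) transport along the exact isomorphisms; the point hypothesis is the re-index junction
  exact cover_transport_along_iso ((D.baseChange ℓ₁).baseChange x) (D.baseChange (x ≫ ℓ₁)) ((D.baseChange ℓ₂).baseChange x) (D.baseChange (x ≫ ℓ₂))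
    hD₁ hD₂ hD₁' hD₂' (baseChangeHom (pol.baseChange ℓ₁).lam x) (pol.baseChange (x ≫ ℓ₁)).lam (baseChangeHom (pol.baseChange ℓ₂).lam x) (pol.baseChange (x ≫ ℓ₂)).lam
    (fun a => baseChangeHom (baseChangeHom (ρ.i a) ℓ₁) x) (fun a => baseChangeHom (ρ.i a) (x ≫ ℓ₁))
    (fun a => baseChangeHom (baseChangeHom (ρ.i a) ℓ₂) x) (fun a => baseChangeHom (ρ.i a) (x ≫ ℓ₂))
    (fun a => ε₁ (𝒜.restrictPt ℓ₁ (lvl.section_ a))) (fun a => 𝒜.restrictPt (x ≫ ℓ₁) (lvl.section_ a))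
    (fun a => ε₂ (𝒜.restrictPt ℓ₂ (lvl.section_ a))) (fun a => 𝒜.restrictPt (x ≫ ℓ₂) (lvl.section_ a))
    𝔞 𝔟 ν e₁ e₂ N he₁lam he₂lam he₁act he₂act
    (fun a => 𝒜.map_pointsTransfer_restrictPt_of_left_eq_baseChangeCompGrpIso_inv ℓ₁ x hε₁ e₁.hom he₁left (lvl.section_ a))
    (fun a => 𝒜.map_pointsTransfer_restrictPt_of_left_eq_baseChangeCompGrpIso_inv ℓ₂ x hε₂ e₂.hom he₂left (lvl.section_ a))
    hbc

end ReadAt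

/-! ### §2 THE BY-VALUE FORMS (the descent `ℂ → F̄_w`): target points `mᵢ` with `hmᵢ : x ≫ ℓᵢ = mᵢ` -/

section OfEq

variable {Y : Scheme.{u}} (𝒜 : AbelianSchemeOver Y) {O : Type*} [CommRing O] (ρ : RingAction O 𝒜) (D : 𝒜.DualPair)
  (hD : Nonempty ((Scheme.Modules.pullback D.unitHatSlice).obj D.P ≅ SheafOfModules.unit _))
  (pol : 𝒜.Polarization D) {g n : ℕ} (lvl : 𝒜.LevelStructure g n)
  {Ω Ω' : Type u} [Field Ω] [Field Ω'] (ℓ₁ ℓ₂ : Spec (.of Ω) ⟶ Y) (x : Spec (.of Ω') ⟶ Spec (.of Ω))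
  (m₁ m₂ : Spec (.of Ω') ⟶ Y) (hm₁ : x ≫ ℓ₁ = m₁) (hm₂ : x ≫ ℓ₂ = m₂)
  (𝔞 𝔟 : O → Prop) (ν : O) (N : ℕ)

include hD hm₁ hm₂ in
/-- **THE SERRE COVER WITH ITS KERNEL CLAUSE, READ AT `(ℓ₁, ℓ₂)` OVER `Ω`, GIVES THE READING AT `(m₁, m₂)` OVER `Ω′` FOR ANY `x : Spec Ω′ → Spec Ω` WITH
`x ≫ ℓᵢ = mᵢ`** — ★ `coverKer_readAt_comp` (LA4-p03 (g2)) with the target points BY VALUE (`subst`).  USE (the descent `ℂ → F̄_w` of the E-reading `CoverKerE`):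
`Ω := ℂ`, `Ω′ := F̄_w`, `x := Spec σ⁻¹` for `σ : F̄_w ≃ ℂ`, `ℓᵢ := Spec σ ≫ ℓ_{eᵢ} y` (the complex points of the sheet points), `mᵢ := ℓ_{eᵢ} y`,
`hmᵢ := Spec σ⁻¹ ≫ Spec σ = 𝟙`.  Clause texts = `CoverKerE` ((t1) Serre presentation, (t1′) kernel clause on all `T`-points, (t2) upper bound, (t3)
`c ≫ λ₂ ≫ c^∨ = λ₁ ≫ [N]`, (t4) equivariance, (t5) level points) in ★ body currency. [cite: MumfordFogartyKirwan1994, Ch. 7 §2 Definition 7.2 (p. 129) and Definition 7.3 (p. 130)]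
[cite: GortzWedhorn2020, Section (4.7) (pp. 107–108) and Prop. 4.16 (p. 101)] [cite: Shimura1998, §13.1 Theorem 1 (pp. 97–99); §18.6 (pp. 124–127)] -/
theorem coverKer_readAt_comp_of_eq
    (hcover : ∃ (c : (𝒜.baseChange ℓ₁).X ⟶ (𝒜.baseChange ℓ₂).X) (_ : IsMonHom c),
        (∀ a, 𝔞 a → ∃ d : (𝒜.baseChange ℓ₂).X ⟶ (𝒜.baseChange ℓ₁).X,
          c ≫ d = baseChangeHom (ρ.i a) ℓ₁ ∧ d ≫ c = baseChangeHom (ρ.i a) ℓ₂) ∧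
        (∀ ⦃T : Literature.AlgebraicGeometry.Motives.SchemeOver Ω⦄ (t : T ⟶ (𝒜.baseChange ℓ₁).X),
          t ≫ c = 1 ↔ ∀ a, 𝔞 a → t ≫ baseChangeHom (ρ.i a) ℓ₁ = 1) ∧
        (∀ b, 𝔟 b → ∃ f : (𝒜.baseChange ℓ₁).X ⟶ (𝒜.baseChange ℓ₂).X,
          c ≫ baseChangeHom (ρ.i b) ℓ₂ = f ≫ baseChangeHom (ρ.i ν) ℓ₂) ∧
        c ≫ (pol.baseChange ℓ₂).lam ≫ DualPair.dualIsogenyOver c (D.baseChange ℓ₁) (D.baseChange ℓ₂) =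
          (pol.baseChange ℓ₁).lam ≫ (D.baseChange ℓ₁).hat.mulN N ∧
        (∀ a, baseChangeHom (ρ.i a) ℓ₁ ≫ c = c ≫ baseChangeHom (ρ.i a) ℓ₂) ∧
        (∀ a : Fin g ⊕ Fin g → ZMod n,
          (AlgPoints.map c (𝒜.restrictPt ℓ₁ (lvl.section_ a)) : (𝒜.baseChange ℓ₂).toAffine.toAbelianVariety.Points Ω) =
            𝒜.restrictPt ℓ₂ (lvl.section_ a))) :
    ∃ (c : (𝒜.baseChange m₁).X ⟶ (𝒜.baseChange m₂).X) (_ : IsMonHom c),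
        (∀ a, 𝔞 a → ∃ d : (𝒜.baseChange m₂).X ⟶ (𝒜.baseChange m₁).X,
          c ≫ d = baseChangeHom (ρ.i a) m₁ ∧ d ≫ c = baseChangeHom (ρ.i a) m₂) ∧
        (∀ ⦃T : Literature.AlgebraicGeometry.Motives.SchemeOver Ω'⦄ (t : T ⟶ (𝒜.baseChange m₁).X),
          t ≫ c = 1 ↔ ∀ a, 𝔞 a → t ≫ baseChangeHom (ρ.i a) m₁ = 1) ∧
        (∀ b, 𝔟 b → ∃ f : (𝒜.baseChange m₁).X ⟶ (𝒜.baseChange m₂).X,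
          c ≫ baseChangeHom (ρ.i b) m₂ = f ≫ baseChangeHom (ρ.i ν) m₂) ∧
        c ≫ (pol.baseChange m₂).lam ≫ DualPair.dualIsogenyOver c (D.baseChange m₁) (D.baseChange m₂) =
          (pol.baseChange m₁).lam ≫ (D.baseChange m₁).hat.mulN N ∧
        (∀ a, baseChangeHom (ρ.i a) m₁ ≫ c = c ≫ baseChangeHom (ρ.i a) m₂) ∧
        (∀ a : Fin g ⊕ Fin g → ZMod n,
          (AlgPoints.map c (𝒜.restrictPt m₁ (lvl.section_ a)) : (𝒜.baseChange m₂).toAffine.toAbelianVariety.Points Ω') =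
            𝒜.restrictPt m₂ (lvl.section_ a)) := by
  subst hm₁ hm₂
  exact coverKer_readAt_comp 𝒜 ρ D hD pol lvl ℓ₁ ℓ₂ x 𝔞 𝔟 ν N hcover

include hD hm₁ hm₂ in
/-- **THE SERRE COVER (NO KERNEL CLAUSE), READ AT `(ℓ₁, ℓ₂)` OVER `Ω`, GIVES THE READING AT `(m₁, m₂)` OVER `Ω′` FOR ANY `x : Spec Ω′ → Spec Ω` WITH
`x ≫ ℓᵢ = mᵢ`** — §1 `cover_readAt_comp` with the target points BY VALUE (`subst`); clause texts = the E-reading `CoverE` ((t1)–(t5)); the descent `ℂ → F̄_w`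
at `x := Spec σ⁻¹`. [cite: MumfordFogartyKirwan1994, Ch. 7 §2 Definition 7.2 (p. 129) and Definition 7.3 (p. 130)] [cite: GortzWedhorn2020, Section (4.7) (pp. 107–108) and Prop. 4.16 (p. 101)]
[cite: Shimura1998, §13.1 Theorem 1 (pp. 97–99); §18.6 (pp. 124–127)] -/
theorem cover_readAt_comp_of_eq
    (hcover : ∃ (c : (𝒜.baseChange ℓ₁).X ⟶ (𝒜.baseChange ℓ₂).X) (_ : IsMonHom c),
        (∀ a, 𝔞 a → ∃ d : (𝒜.baseChange ℓ₂).X ⟶ (𝒜.baseChange ℓ₁).X,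
          c ≫ d = baseChangeHom (ρ.i a) ℓ₁ ∧ d ≫ c = baseChangeHom (ρ.i a) ℓ₂) ∧
        (∀ b, 𝔟 b → ∃ f : (𝒜.baseChange ℓ₁).X ⟶ (𝒜.baseChange ℓ₂).X,
          c ≫ baseChangeHom (ρ.i b) ℓ₂ = f ≫ baseChangeHom (ρ.i ν) ℓ₂) ∧
        c ≫ (pol.baseChange ℓ₂).lam ≫ DualPair.dualIsogenyOver c (D.baseChange ℓ₁) (D.baseChange ℓ₂) =
          (pol.baseChange ℓ₁).lam ≫ (D.baseChange ℓ₁).hat.mulN N ∧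
        (∀ a, baseChangeHom (ρ.i a) ℓ₁ ≫ c = c ≫ baseChangeHom (ρ.i a) ℓ₂) ∧
        (∀ a : Fin g ⊕ Fin g → ZMod n,
          (AlgPoints.map c (𝒜.restrictPt ℓ₁ (lvl.section_ a)) : (𝒜.baseChange ℓ₂).toAffine.toAbelianVariety.Points Ω) =
            𝒜.restrictPt ℓ₂ (lvl.section_ a))) :
    ∃ (c : (𝒜.baseChange m₁).X ⟶ (𝒜.baseChange m₂).X) (_ : IsMonHom c),
        (∀ a, 𝔞 a → ∃ d : (𝒜.baseChange m₂).X ⟶ (𝒜.baseChange m₁).X,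
          c ≫ d = baseChangeHom (ρ.i a) m₁ ∧ d ≫ c = baseChangeHom (ρ.i a) m₂) ∧
        (∀ b, 𝔟 b → ∃ f : (𝒜.baseChange m₁).X ⟶ (𝒜.baseChange m₂).X,
          c ≫ baseChangeHom (ρ.i b) m₂ = f ≫ baseChangeHom (ρ.i ν) m₂) ∧
        c ≫ (pol.baseChange m₂).lam ≫ DualPair.dualIsogenyOver c (D.baseChange m₁) (D.baseChange m₂) =
          (pol.baseChange m₁).lam ≫ (D.baseChange m₁).hat.mulN N ∧
        (∀ a, baseChangeHom (ρ.i a) m₁ ≫ c = c ≫ baseChangeHom (ρ.i a) m₂) ∧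
        (∀ a : Fin g ⊕ Fin g → ZMod n,
          (AlgPoints.map c (𝒜.restrictPt m₁ (lvl.section_ a)) : (𝒜.baseChange m₂).toAffine.toAbelianVariety.Points Ω') =
            𝒜.restrictPt m₂ (lvl.section_ a)) := by
  subst hm₁ hm₂
  exact cover_readAt_comp 𝒜 ρ D hD pol lvl ℓ₁ ℓ₂ x 𝔞 𝔟 ν N hcover

end OfEq

/-! ### §3 The reading at `(x ≫ ℓ₁, x ≫ ℓ₂)` over `Ω′` gives back the reading at `(ℓ₁, ℓ₂)` over `Ω` when `x` is an isomorphism -/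

section Back

variable {Y : Scheme.{u}} (𝒜 : AbelianSchemeOver Y) {O : Type*} [CommRing O] (ρ : RingAction O 𝒜) (D : 𝒜.DualPair)
  (hD : Nonempty ((Scheme.Modules.pullback D.unitHatSlice).obj D.P ≅ SheafOfModules.unit _))
  (pol : 𝒜.Polarization D) {g n : ℕ} (lvl : 𝒜.LevelStructure g n)
  {Ω Ω' : Type u} [Field Ω] [Field Ω'] (ℓ₁ ℓ₂ : Spec (.of Ω) ⟶ Y) (x : Spec (.of Ω') ⟶ Spec (.of Ω)) [IsIso x]
  (𝔞 𝔟 : O → Prop) (ν : O) (N : ℕ)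

include hD in
/-- **BACK ALONG AN ISOMORPHISM OF POINT BASES (with kernel clause)**: for `x : Spec Ω′ ⟶ Spec Ω` an isomorphism, the `CoverKerE`-shaped reading of the
family at `(x ≫ ℓ₁, x ≫ ℓ₂)` over `Ω′` gives the reading at `(ℓ₁, ℓ₂)` over `Ω` — §2 along `inv x` (`inv x ≫ x ≫ ℓᵢ = ℓᵢ`).  USE: `x := Spec σ` for
`σ : F̄_w ≃ ℂ`; a cover produced at the complex points `Spec σ ≫ ℓ_{e′} y` is read back at the `F̄_w`-sheet points. [cite: MumfordFogartyKirwan1994, Ch. 7 §2 Definition 7.2 (p. 129) and Definition 7.3 (p. 130)]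
[cite: GortzWedhorn2020, Section (4.7) (pp. 107–108) and Prop. 4.16 (p. 101)] [cite: Shimura1998, §13.1 Theorem 1 (pp. 97–99); §18.6 (pp. 124–127)] -/
theorem coverKer_readAt_of_readAt_isIso_comp
    (hcover : ∃ (c : (𝒜.baseChange (x ≫ ℓ₁)).X ⟶ (𝒜.baseChange (x ≫ ℓ₂)).X) (_ : IsMonHom c),
        (∀ a, 𝔞 a → ∃ d : (𝒜.baseChange (x ≫ ℓ₂)).X ⟶ (𝒜.baseChange (x ≫ ℓ₁)).X,
          c ≫ d = baseChangeHom (ρ.i a) (x ≫ ℓ₁) ∧ d ≫ c = baseChangeHom (ρ.i a) (x ≫ ℓ₂)) ∧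
        (∀ ⦃T : Literature.AlgebraicGeometry.Motives.SchemeOver Ω'⦄ (t : T ⟶ (𝒜.baseChange (x ≫ ℓ₁)).X),
          t ≫ c = 1 ↔ ∀ a, 𝔞 a → t ≫ baseChangeHom (ρ.i a) (x ≫ ℓ₁) = 1) ∧
        (∀ b, 𝔟 b → ∃ f : (𝒜.baseChange (x ≫ ℓ₁)).X ⟶ (𝒜.baseChange (x ≫ ℓ₂)).X,
          c ≫ baseChangeHom (ρ.i b) (x ≫ ℓ₂) = f ≫ baseChangeHom (ρ.i ν) (x ≫ ℓ₂)) ∧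
        c ≫ (pol.baseChange (x ≫ ℓ₂)).lam ≫ DualPair.dualIsogenyOver c (D.baseChange (x ≫ ℓ₁)) (D.baseChange (x ≫ ℓ₂)) =
          (pol.baseChange (x ≫ ℓ₁)).lam ≫ (D.baseChange (x ≫ ℓ₁)).hat.mulN N ∧
        (∀ a, baseChangeHom (ρ.i a) (x ≫ ℓ₁) ≫ c = c ≫ baseChangeHom (ρ.i a) (x ≫ ℓ₂)) ∧
        (∀ a : Fin g ⊕ Fin g → ZMod n,
          (AlgPoints.map c (𝒜.restrictPt (x ≫ ℓ₁) (lvl.section_ a)) : (𝒜.baseChange (x ≫ ℓ₂)).toAffine.toAbelianVariety.Points Ω') =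
            𝒜.restrictPt (x ≫ ℓ₂) (lvl.section_ a))) :
    ∃ (c : (𝒜.baseChange ℓ₁).X ⟶ (𝒜.baseChange ℓ₂).X) (_ : IsMonHom c),
        (∀ a, 𝔞 a → ∃ d : (𝒜.baseChange ℓ₂).X ⟶ (𝒜.baseChange ℓ₁).X,
          c ≫ d = baseChangeHom (ρ.i a) ℓ₁ ∧ d ≫ c = baseChangeHom (ρ.i a) ℓ₂) ∧
        (∀ ⦃T : Literature.AlgebraicGeometry.Motives.SchemeOver Ω⦄ (t : T ⟶ (𝒜.baseChange ℓ₁).X),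
          t ≫ c = 1 ↔ ∀ a, 𝔞 a → t ≫ baseChangeHom (ρ.i a) ℓ₁ = 1) ∧
        (∀ b, 𝔟 b → ∃ f : (𝒜.baseChange ℓ₁).X ⟶ (𝒜.baseChange ℓ₂).X,
          c ≫ baseChangeHom (ρ.i b) ℓ₂ = f ≫ baseChangeHom (ρ.i ν) ℓ₂) ∧
        c ≫ (pol.baseChange ℓ₂).lam ≫ DualPair.dualIsogenyOver c (D.baseChange ℓ₁) (D.baseChange ℓ₂) =
          (pol.baseChange ℓ₁).lam ≫ (D.baseChange ℓ₁).hat.mulN N ∧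
        (∀ a, baseChangeHom (ρ.i a) ℓ₁ ≫ c = c ≫ baseChangeHom (ρ.i a) ℓ₂) ∧
        (∀ a : Fin g ⊕ Fin g → ZMod n,
          (AlgPoints.map c (𝒜.restrictPt ℓ₁ (lvl.section_ a)) : (𝒜.baseChange ℓ₂).toAffine.toAbelianVariety.Points Ω) =
            𝒜.restrictPt ℓ₂ (lvl.section_ a)) :=
  coverKer_readAt_comp_of_eq 𝒜 ρ D hD pol lvl (x ≫ ℓ₁) (x ≫ ℓ₂) (inv x) ℓ₁ ℓ₂ (IsIso.inv_hom_id_assoc x ℓ₁) (IsIso.inv_hom_id_assoc x ℓ₂)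
    𝔞 𝔟 ν N hcover

include hD in
/-- **BACK ALONG AN ISOMORPHISM OF POINT BASES (no kernel clause)**: the `CoverE`-shaped reading at `(x ≫ ℓ₁, x ≫ ℓ₂)` over `Ω′` gives the reading at
`(ℓ₁, ℓ₂)` over `Ω` for `x` an isomorphism — §2 along `inv x`. [cite: MumfordFogartyKirwan1994, Ch. 7 §2 Definition 7.2 (p. 129) and Definition 7.3 (p. 130)]
[cite: GortzWedhorn2020, Section (4.7) (pp. 107–108) and Prop. 4.16 (p. 101)] [cite: Shimura1998, §13.1 Theorem 1 (pp. 97–99); §18.6 (pp. 124–127)] -/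
theorem cover_readAt_of_readAt_isIso_comp
    (hcover : ∃ (c : (𝒜.baseChange (x ≫ ℓ₁)).X ⟶ (𝒜.baseChange (x ≫ ℓ₂)).X) (_ : IsMonHom c),
        (∀ a, 𝔞 a → ∃ d : (𝒜.baseChange (x ≫ ℓ₂)).X ⟶ (𝒜.baseChange (x ≫ ℓ₁)).X,
          c ≫ d = baseChangeHom (ρ.i a) (x ≫ ℓ₁) ∧ d ≫ c = baseChangeHom (ρ.i a) (x ≫ ℓ₂)) ∧
        (∀ b, 𝔟 b → ∃ f : (𝒜.baseChange (x ≫ ℓ₁)).X ⟶ (𝒜.baseChange (x ≫ ℓ₂)).X,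
          c ≫ baseChangeHom (ρ.i b) (x ≫ ℓ₂) = f ≫ baseChangeHom (ρ.i ν) (x ≫ ℓ₂)) ∧
        c ≫ (pol.baseChange (x ≫ ℓ₂)).lam ≫ DualPair.dualIsogenyOver c (D.baseChange (x ≫ ℓ₁)) (D.baseChange (x ≫ ℓ₂)) =
          (pol.baseChange (x ≫ ℓ₁)).lam ≫ (D.baseChange (x ≫ ℓ₁)).hat.mulN N ∧
        (∀ a, baseChangeHom (ρ.i a) (x ≫ ℓ₁) ≫ c = c ≫ baseChangeHom (ρ.i a) (x ≫ ℓ₂)) ∧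
        (∀ a : Fin g ⊕ Fin g → ZMod n,
          (AlgPoints.map c (𝒜.restrictPt (x ≫ ℓ₁) (lvl.section_ a)) : (𝒜.baseChange (x ≫ ℓ₂)).toAffine.toAbelianVariety.Points Ω') =
            𝒜.restrictPt (x ≫ ℓ₂) (lvl.section_ a))) :
    ∃ (c : (𝒜.baseChange ℓ₁).X ⟶ (𝒜.baseChange ℓ₂).X) (_ : IsMonHom c),
        (∀ a, 𝔞 a → ∃ d : (𝒜.baseChange ℓ₂).X ⟶ (𝒜.baseChange ℓ₁).X,
          c ≫ d = baseChangeHom (ρ.i a) ℓ₁ ∧ d ≫ c = baseChangeHom (ρ.i a) ℓ₂) ∧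
        (∀ b, 𝔟 b → ∃ f : (𝒜.baseChange ℓ₁).X ⟶ (𝒜.baseChange ℓ₂).X,
          c ≫ baseChangeHom (ρ.i b) ℓ₂ = f ≫ baseChangeHom (ρ.i ν) ℓ₂) ∧
        c ≫ (pol.baseChange ℓ₂).lam ≫ DualPair.dualIsogenyOver c (D.baseChange ℓ₁) (D.baseChange ℓ₂) =
          (pol.baseChange ℓ₁).lam ≫ (D.baseChange ℓ₁).hat.mulN N ∧
        (∀ a, baseChangeHom (ρ.i a) ℓ₁ ≫ c = c ≫ baseChangeHom (ρ.i a) ℓ₂) ∧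
        (∀ a : Fin g ⊕ Fin g → ZMod n,
          (AlgPoints.map c (𝒜.restrictPt ℓ₁ (lvl.section_ a)) : (𝒜.baseChange ℓ₂).toAffine.toAbelianVariety.Points Ω) =
            𝒜.restrictPt ℓ₂ (lvl.section_ a)) :=
  cover_readAt_comp_of_eq 𝒜 ρ D hD pol lvl (x ≫ ℓ₁) (x ≫ ℓ₂) (inv x) ℓ₁ ℓ₂ (IsIso.inv_hom_id_assoc x ℓ₁) (IsIso.inv_hom_id_assoc x ℓ₂)
    𝔞 𝔟 ν N hcover

end Back

end AbelianSchemeOver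

end Literature.AlgebraicGeometry.AbelianSchemes

end
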